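import Literature.AnabelianGeometry.AbsoluteAnabelian.AbsAnabLemma114GenuineCarrierInstances
import Summits.ABC.IUTFork.MLFGaloisTFG
import HarnessLib

/-!
# [AbsAnab] Lemma 1.1.4 (i) FAILS at every MLF base — UNCONDITIONAL (vacuity certificate)

Cell `abc-iut` (run/shared/lean/pub/abc-iut/), layer L4, D-0079 L-F row F-0005 `GeomIsMaxTFGNormalIn`
(plan/L4/LF-ABSTOP.tsv).  S. Mochizuki, *The Absolute Anabelian Geometry of Hyperbolic Curves* (2004)
[AbsAnab], Lemma 1.1.4 (i) p. 7 is stated for `G = G_F`, `F` a NUMBER FIELD.  The Literature file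
`AbsAnabLemma114GenuineCarrierInstances.lean` (p456147) proves that at an MLF base the typed predicate
`E.GeomIsMaxTFGNormalIn Π′` FAILS for every open `Π′ ⊆ Π` as soon as `Δ` and `G` are topologically
finitely generated, carrying `G` tfg as a binder `hG` (a Literature file may not import the Summits-side
theorem `isTopologicallyFinitelyGenerated_absoluteGaloisGroup_padic`, [NSW] Thm 7.5.10, file
`Summits/ABC/IUTFork/MLFGaloisTFG.lean`).  HERE the binder is discharged:

* `MLFBase.not_geomIsMaxTFGNormalIn` — for EVERY extension with MLF base data and `Δ` tfg, and every
  open `Π′`, `¬ E.GeomIsMaxTFGNormalIn Π′`;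
* `MLFBase.not_geomIsMaxTFGNormalIn_top'` — `¬ E.GeomIsMaxTFGNormalIn ⊤` for EVERY extension with MLF
  base data (no hypothesis on `Δ`);
* `not_exists_mlfBase_geomIsMaxTFGNormalIn_top` — VACUITY CERTIFICATE: no extension with MLF base data
  satisfies `GeomIsMaxTFGNormalIn ⊤`; hence the hypothesis sets of the MLF-base consumers of this
  predicate (`FundamentalExtension.thm214GroupPart_of_geomIsMaxTFGNormalIn (B₁ : E.MLFBase)
  (B₂ : F.MLFBase) (hE : E.GeomIsMaxTFGNormalIn ⊤) (hF : F.GeomIsMaxTFGNormalIn ⊤)`, p413345) are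
  EMPTY — those theorems are true but void; the non-vacuous [AbsTopI] Thm 2.14 (i) / [AbsTopII]
  Rmk 3.3.2 closers over MLF bases are the `StarCondition` / `CoinvariantRankConstant` / `Thm26v` /
  almost-pro-`Σ` ones (`thm214GroupPart_of_starCondition`, `MLFBase.thm214GroupPart_of_isAlmostPro`,
  `thm214GroupPart_gfg_affine`).

HONEST FRAMING: a statement about OUR typed predicate at MLF bases (print never claims Lemma 1.1.4 (i)
there); classical inputs only; nothing here bears on [IUTchIII] Cor. 3.12 or takes a side.
-/

noncomputable section

namespace Summit.ABC.IUTFork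

open Literature.AnabelianGeometry.AbsoluteAnabelian

/-- **`GeomIsMaxTFGNormalIn Π′` fails at every MLF base, unconditionally** (`Δ` tfg, `Π′ ⊆ Π` open):
`G ≅ G_K` is tfg ([NSW] Thm 7.5.10, `isTopologicallyFinitelyGenerated_gal_of_mlfBase`), so `Π′` is a tfg
closed normal subgroup of itself not contained in `Δ`. [cite: MochizukiAbsAnab2004, Lemma 1.1.4 (i) p.7] -/
theorem _root_.Literature.AnabelianGeometry.AbsoluteAnabelian.FundamentalExtension.MLFBase.not_geomIsMaxTFGNormalIn
    {E : FundamentalExtension.{0}} (B : E.MLFBase) (hΔ : E.GeomTFG) (Q : Subgroup E.arith)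
    (hQ : IsOpen (Q : Set E.arith)) : ¬ E.GeomIsMaxTFGNormalIn Q :=
  B.not_geomIsMaxTFGNormalIn_of_tfg hΔ
    (FundamentalExtension.isTopologicallyFinitelyGenerated_gal_of_mlfBase B) Q hQ

/-- **`GeomIsMaxTFGNormalIn ⊤` fails at every MLF base, unconditionally** (no hypothesis on `Δ`: its
finite generation is the first conjunct of the predicate). [cite: MochizukiAbsAnab2004, Lemma 1.1.4 (i) p.7] -/
theorem _root_.Literature.AnabelianGeometry.AbsoluteAnabelian.FundamentalExtension.MLFBase.not_geomIsMaxTFGNormalIn_top'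
    {E : FundamentalExtension.{0}} (B : E.MLFBase) : ¬ E.GeomIsMaxTFGNormalIn ⊤ :=
  B.not_geomIsMaxTFGNormalIn_top_of_tfg
    (FundamentalExtension.isTopologicallyFinitelyGenerated_gal_of_mlfBase B)

/-- **VACUITY CERTIFICATE**: there is NO extension `1 → Δ → Π → G → 1` with MLF base data in which `Δ`
is the maximal topologically finitely generated closed normal subgroup of `Π` — the hypothesis
`GeomIsMaxTFGNormalIn ⊤` of the MLF-base consumers (e.g. `thm214GroupPart_of_geomIsMaxTFGNormalIn`) is
never satisfied. [cite: MochizukiAbsAnab2004, Lemma 1.1.4 (i) p.7] -/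
theorem not_exists_mlfBase_geomIsMaxTFGNormalIn_top :
    ¬ ∃ (E : FundamentalExtension.{0}) (_ : E.MLFBase), E.GeomIsMaxTFGNormalIn ⊤ := by
  rintro ⟨E, B, h⟩
  exact B.not_geomIsMaxTFGNormalIn_top' h

/-- Equivalently: the conjunction of hypotheses of `thm214GroupPart_of_geomIsMaxTFGNormalIn` is
unsatisfiable for every pair of extensions with MLF base data.
[cite: MochizukiAbsTopI2012, Thm 2.14 (i) p.33] -/
theorem thm214GroupPart_of_geomIsMaxTFGNormalIn_hypotheses_empty
    {E F : FundamentalExtension.{0}} (B₁ : E.MLFBase) (_B₂ : F.MLFBase) :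
    ¬ (E.GeomIsMaxTFGNormalIn ⊤ ∧ F.GeomIsMaxTFGNormalIn ⊤) :=
  fun h => B₁.not_geomIsMaxTFGNormalIn_top' h.1

end Summit.ABC.IUTFork

end
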